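import Literature.Topology.FourManifolds.TrisectionsKappaConst
import Literature.Topology.FourManifolds.TrisectionsRenormalise
import Literature.Topology.FourManifolds.TrisectionsImplantModel
import Literature.Topology.FourManifolds.TrisectionsImplantSector
import Literature.Topology.FourManifolds.TrisectionsProductStructure
import Literature.Topology.FourManifolds.RegularLevelSplitting
import Literature.Topology.FourManifolds.MorseTurnAbout
import HarnessLib

/-!
# The unbalanced stabilisation of a trisection in normal form (one implant)

Topic `Literature/Topology/FourManifolds`; infrastructure for the fact seat
`provefact-Literature.Topology.FourManifolds.exists-14560f9fc8` (named fact (c′)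
`Literature.Topology.FourManifolds.exists_stabilized_gkTrisection`, Gay–Kirby 2016, Def. 8 and
Lemma 10).  Everything in this file is **proved**; no definitions, no named facts.

**Theorem (`TriNormalForm.exists_implant`).**  *Let `(S, i, j, l, u, v, ρ, U, O)` be a
trisection in normal form (`TriNormalForm`, `TrisectionsSectorNormalForm.lean`) with counts
`c`, `x` a point of the central surface `F = ⋂ S m` and `Ω ∋ x` open.  There is a trisection in
normal form `(S', i, j, l, u', v', ρ', U, O')` with counts `c'`, `c' i n = c i n + [n = 1]`,
`c' j = c j`, `c' l = c l`, which agrees with the old one off `Ω`.*  This is one third of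
Gay–Kirby's stabilisation (Def. 8, proof of Lemma 10: one eye added to the trisected Morse
`2`-function): the sector `S' i` gains one `1`-handle, the other two keep their handle
decompositions, the central surface gains genus one.

**Proof.**  Choose ambient presentations of the three sectors with corner coefficients constant
near `x` (`SectorNormalForm.exists_morse_const`), a corner-slice chart `C` of `S i` at `x` and
the chart `Θ̃ = A ∘ C.Θ` of the maximal atlas (`A` linear) in which `u = (x₃ - x₀)/2`,
`v = (-x₃ - x₀)/2`; implant the model (`Implant.exists_implant`) in a small ball, glue the new
normal coordinates `u', v'` (`TrisectionsImplantGlue.lean`), form the modified sets, produce the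
new frame by the product-structure theorem (`exists_cornerSliceChart_of_normalCoordinates`)
fed with adapted charts (the model's on the implant, the old corner-slice charts elsewhere),
corner-slice charts of the other two sectors by relabelling, half-slice charts (old ones off the
implant, regular-inequality ones on it), the raw presentations of the three new sectors
(`sector_rawPresentation_of_implant`) and finally renormalise them to the new retraction
(`sectorNormalForm_of_rawPresentation`).

## References

* D. Gay, R. Kirby, *Trisecting 4-manifolds*, Geom. Topol. 20 (2016) 3097–3132, Def. 8,
  Lemma 10 and its proof. [GayKirby2016]
* J. Milnor, *Lectures on the h-cobordism theorem* (1965), Lemma 8.2. [MilnorHCobordism1965]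
* J. Milnor, *Morse theory* (1963), §§2–3. [Milnor1963]
-/

open scoped Manifold ContDiff Topology Classical
open Set Function Filter Metric

noncomputable section

namespace Literature.Topology.FourManifolds

universe u

section Implant

variable {X : Type u} [TopologicalSpace X] [T2Space X] [CompactSpace X]
  [ChartedSpace (EuclideanSpace ℝ (Fin 4)) X] [IsManifold (𝓡 4) ∞ X]
  {S : Fin 3 → Set X} {i j l : Fin 3} {u v : X → ℝ} {ρ : X → X} {U O : Set X}
  {c : Fin 3 → ℕ → ℕ}

omit [CompactSpace X] in
/-- **Half-slice charts of a modified sector.**  Off the carrier `KX` the old half-slice charts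
(restricted to `KXᶜ`, where old and new sets agree) serve; on `KX` the new normal coordinates
`an, bn` are regular, and at a point with `bn > 0` (resp. `an > 0`) the set is the regular
superlevel set `{an ≥ 0}` (resp. `{bn ≥ 0}`) inside the open set `U ∩ {bn > 0}`
(`exists_halfSliceChart_of_not_isMCriticalPt'`, transferred by `exists_halfSliceChart_of_inter_eq`).
[cite: GayKirby2016, Def. 8] -/
theorem exists_halfSliceChart_of_implant {U KX Sold Fold Sn Fn : Set X} {an bn : X → ℝ}
    (hUo : IsOpen U) (hKXc : IsCompact KX) (hKXU : KX ⊆ U)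
    (hans : ContMDiff (𝓡 4) 𝓘(ℝ, ℝ) ∞ an) (hbns : ContMDiff (𝓡 4) 𝓘(ℝ, ℝ) ∞ bn)
    (hmemn : ∀ y ∈ U, y ∈ Sn ↔ 0 ≤ an y ∧ 0 ≤ bn y)
    (hFnmem : ∀ y ∈ U, y ∈ Fn ↔ an y = 0 ∧ bn y = 0)
    (hSnS : ∀ y ∉ KX, y ∈ Sn ↔ y ∈ Sold) (hFnF : ∀ y ∉ KX, y ∈ Fn ↔ y ∈ Fold)
    (hhalf : ∀ p ∈ Sold, p ∉ Fold → ∃ D : HalfSliceChart (𝓡 4) Sold, p ∈ D.Θ.source ∧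
      ∀ q ∈ D.Θ.source, q ∉ Fold)
    (hanreg : ∀ y ∈ KX, ¬ IsMCriticalPt (𝓡 4) an y) (hbnreg : ∀ y ∈ KX, ¬ IsMCriticalPt (𝓡 4) bn y) :
    ∀ p ∈ Sn, p ∉ Fn → ∃ D : HalfSliceChart (𝓡 4) Sn, p ∈ D.Θ.source ∧ ∀ q ∈ D.Θ.source, q ∉ Fn := by
  intro p hpSn hpFn
  by_cases hpK : p ∈ KX
  · have hpU : p ∈ U := hKXU hpK
    obtain ⟨ha0, hb0⟩ := (hmemn p hpU).1 hpSn
    have hnotboth : ¬ (an p = 0 ∧ bn p = 0) := fun h => hpFn ((hFnmem p hpU).2 h)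
    -- the generic construction from a regular inequality `{w ≥ 0}` inside `U ∩ {w' > 0}`
    have key : ∀ {w w' : X → ℝ}, ContMDiff (𝓡 4) 𝓘(ℝ, ℝ) ∞ w → ContMDiff (𝓡 4) 𝓘(ℝ, ℝ) ∞ w' →
        ¬ IsMCriticalPt (𝓡 4) w p → 0 < w' p →
        (∀ y ∈ U, y ∈ Sn ↔ 0 ≤ w y ∧ 0 ≤ w' y) → (∀ y ∈ U, y ∈ Fn → w' y = 0) →
        ∃ D : HalfSliceChart (𝓡 4) Sn, p ∈ D.Θ.source ∧ ∀ q ∈ D.Θ.source, q ∉ Fn := by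
      intro w w' hws hw's hreg hpos hmem' hFn'
      have hreg' : ¬ IsMCriticalPt (𝓡 4) (fun y => 0 - w y) p := by
        rwa [isMCriticalPt_const_sub_iff 0 (hws.mdifferentiableAt (by simp))]
      obtain ⟨D₀, hpD₀, -⟩ := exists_halfSliceChart_of_not_isMCriticalPt' (k := 3)
        (contMDiff_const.sub hws) 0 hreg'
      set V : Set X := U ∩ w' ⁻¹' Ioi 0 with hV
      have hVo : IsOpen V := hUo.inter (isOpen_Ioi.preimage hw's.continuous)
      have hpV : p ∈ V := ⟨hpU, hpos⟩
      have hagree : ∀ q ∈ V, q ∈ (fun y => 0 - w y) ⁻¹' Iic (0:ℝ) ↔ q ∈ Sn := by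
        rintro q ⟨hqU, hqpos⟩
        rw [hmem' q hqU]
        simp only [mem_preimage, mem_Iic, zero_sub, neg_nonpos]
        exact ⟨fun h => ⟨h, le_of_lt hqpos⟩, fun h => h.1⟩
      obtain ⟨D, hDsrc, -⟩ := exists_halfSliceChart_of_inter_eq D₀ hVo hagree
      refine ⟨D, by rw [hDsrc]; exact ⟨hpD₀, hpV⟩, fun q hq hqFn => ?_⟩
      rw [hDsrc] at hq
      have hq0 := hFn' q hq.2.1 hqFn
      have : (0:ℝ) < w' q := hq.2.2
      rw [hq0] at this; exact lt_irrefl _ this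
    by_cases hb : 0 < bn p
    · exact key hans hbns (hanreg p hpK) hb hmemn (fun y hy hyF => ((hFnmem y hy).1 hyF).2)
    · have hb0' : bn p = 0 := le_antisymm (not_lt.1 hb) hb0
      have ha : 0 < an p := lt_of_le_of_ne ha0 fun h => hnotboth ⟨h.symm, hb0'⟩
      exact key hbns hans (hbnreg p hpK) ha
        (fun y hy => by rw [hmemn y hy]; exact and_comm) (fun y hy hyF => ((hFnmem y hy).1 hyF).1)
  · have hpS : p ∈ Sold := (hSnS p hpK).1 hpSn
    have hpF : p ∉ Fold := fun h => hpFn ((hFnF p hpK).2 h)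
    obtain ⟨D₀, hpD₀, hD₀F⟩ := hhalf p hpS hpF
    obtain ⟨D, hDsrc, -⟩ := exists_halfSliceChart_of_inter_eq D₀ hKXc.isClosed.isOpen_compl
      (fun q hq => (hSnS q hq).symm)
    refine ⟨D, by rw [hDsrc]; exact ⟨hpD₀, hpK⟩, fun q hq hqFn => ?_⟩
    rw [hDsrc] at hq
    exact hD₀F q hq.1 ((hFnF q hq.2).1 hqFn)

/-- A critical point of `-ũṽ` in the open quadrant lies in the carrier box `Kb`: off `Kb` the
function is `(x₃² - x₀²)/4`, critical only where `x₃ = x₀ = 0`, i.e. where `ũ = 0`. [folklore] -/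
theorem Implant.mem_of_isMCriticalPt_quadrant {uN vN : EuclideanSpace ℝ (Fin 4) → ℝ}
    {Kb : Set (EuclideanSpace ℝ (Fin 4))} (hKb : IsClosed Kb)
    (hout : ∀ z ∉ Kb, uN z = (z 3 - z 0) / 2 ∧ vN z = (-z 3 - z 0) / 2)
    {xs : EuclideanSpace ℝ (Fin 4)} (hu : 0 < uN xs)
    (hcrit : IsMCriticalPt (𝓡 4) (fun z => -(uN z * vN z)) xs) : xs ∈ Kb := by
  by_contra hxs
  have heq : (fun z => -(uN z * vN z)) =ᶠ[𝓝 xs] fun z => (z 3 ^ 2 - z 0 ^ 2) / 4 := by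
    filter_upwards [hKb.isOpen_compl.mem_nhds hxs] with z hz
    rw [(hout z hz).1, (hout z hz).2]; ring
  rw [MorseBirth.isMCriticalPt_iff_fderiv, heq.fderiv_eq] at hcrit
  have h3 : HasFDerivAt (fun z : EuclideanSpace ℝ (Fin 4) => z 3)
      (EuclideanSpace.proj (3 : Fin 4) : EuclideanSpace ℝ (Fin 4) →L[ℝ] ℝ) xs :=
    (EuclideanSpace.proj (3 : Fin 4) : EuclideanSpace ℝ (Fin 4) →L[ℝ] ℝ).hasFDerivAt
  have h0 : HasFDerivAt (fun z : EuclideanSpace ℝ (Fin 4) => z 0)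
      (EuclideanSpace.proj (0 : Fin 4) : EuclideanSpace ℝ (Fin 4) →L[ℝ] ℝ) xs :=
    (EuclideanSpace.proj (0 : Fin 4) : EuclideanSpace ℝ (Fin 4) →L[ℝ] ℝ).hasFDerivAt
  have hd : HasFDerivAt (fun z : EuclideanSpace ℝ (Fin 4) => (z 3 ^ 2 - z 0 ^ 2) / 4)
      ((1 / 4 : ℝ) • ((xs 3 • (EuclideanSpace.proj (3 : Fin 4) : EuclideanSpace ℝ (Fin 4) →L[ℝ] ℝ) +
        xs 3 • (EuclideanSpace.proj (3 : Fin 4) : EuclideanSpace ℝ (Fin 4) →L[ℝ] ℝ)) -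
        (xs 0 • (EuclideanSpace.proj (0 : Fin 4) : EuclideanSpace ℝ (Fin 4) →L[ℝ] ℝ) +
          xs 0 • (EuclideanSpace.proj (0 : Fin 4) : EuclideanSpace ℝ (Fin 4) →L[ℝ] ℝ)))) xs := by
    have := ((h3.mul h3).sub (h0.mul h0)).const_mul (1 / 4 : ℝ)
    have hfun : (fun z : EuclideanSpace ℝ (Fin 4) => (z 3 ^ 2 - z 0 ^ 2) / 4) =
        fun z => (1 / 4 : ℝ) * (z 3 * z 3 - z 0 * z 0) := by funext z; ring
    rw [hfun]
    exact this
  rw [hd.fderiv] at hcrit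
  have e3 := congrArg (fun L : EuclideanSpace ℝ (Fin 4) →L[ℝ] ℝ => L (EuclideanSpace.single 3 1)) hcrit
  have e0 := congrArg (fun L : EuclideanSpace ℝ (Fin 4) →L[ℝ] ℝ => L (EuclideanSpace.single 0 1)) hcrit
  simp at e3 e0
  have hu0 : uN xs = 0 := by rw [(hout xs hxs).1, e3, e0]; ring
  rw [hu0] at hu; exact lt_irrefl _ hu

/-- **The unbalanced stabilisation (one implant) of a trisection in normal form.**  See the
module docstring. [cite: GayKirby2016, Def. 8, Lemma 10 and its proof] -/
theorem TriNormalForm.exists_implant (hT : TriNormalForm S i j l u v ρ U O c) {x : X}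
    (hx : x ∈ ⋂ m, S m) {Ω : Set X} (hΩ : IsOpen Ω) (hxΩ : x ∈ Ω) :
    ∃ (S' : Fin 3 → Set X) (u' v' : X → ℝ) (ρ' : X → X) (O' : Set X),
      TriNormalForm S' i j l u' v' ρ' U O'
        (Function.update c i (fun n => c i n + if n = 1 then 1 else 0)) ∧
      (∀ m, ∀ y ∉ Ω, y ∈ S' m ↔ y ∈ S m) ∧ (∀ y ∉ Ω, u' y = u y ∧ v' y = v y) := by
  have hfr := hT.frame
  have hij := hT.ne_ij
  have hjl := hT.ne_jl
  have hil := hT.ne_il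
  -- ### ambient presentations with corner coefficients constant near `x`
  obtain ⟨Gi, κi, Oκi, Bxi, hGis, hκis, hOκio, hFOκi, hOκiO, hκipos, hκiρ, hGiform, hb1i, hi1i, hb2i,
    hi2i, hnocriti, hci, hBxio, hxBxi, hBxiOκ, hκiconst⟩ := hT.sector_i.exists_morse_const hfr hx
  obtain ⟨Gj, κj, Oκj, Bxj, hGjs, hκjs, hOκjo, hFOκj, hOκjO, hκjpos, hκjρ, hGjform, hb1j, hi1j, hb2j,
    hi2j, hnocritj, hcj, hBxjo, hxBxj, hBxjOκ, hκjconst⟩ :=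
    hT.sector_j.exists_morse_const hfr.relabelTriRot hx
  obtain ⟨Gl, κl, Oκl, Bxl, hGls, hκls, hOκlo, hFOκl, hOκlO, hκlpos, hκlρ, hGlform, hb1l, hi1l, hb2l,
    hi2l, hnocritl, hcl, hBxlo, hxBxl, hBxlOκ, hκlconst⟩ :=
    hT.sector_l.exists_morse_const hfr.relabelTriRot₂ hx
  -- ### the chart `Θt = A ∘ C.Θ`
  obtain ⟨C, hxC, hCO⟩ := hT.sector_i.corner x hx
  let Alin : EuclideanSpace ℝ (Fin 4) ≃ₗ[ℝ] EuclideanSpace ℝ (Fin 4) :=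
    { toFun := fun y => !₂[-(y 0 + y 1), y 2, y 3, y 0 - y 1]
      invFun := fun z => !₂[(z 3 - z 0) / 2, (-z 3 - z 0) / 2, z 1, z 2]
      map_add' := fun y y' => by
        ext k; fin_cases k
        · simp; ring
        · simp
        · simp
        · simp; ring
      map_smul' := fun r y => by
        ext k; fin_cases k
        · simp; ring
        · simp
        · simp
        · simp; ring
      left_inv := fun y => by
        ext k; fin_cases k
        · simp; ring
        · simp; ring
        · simp
        · simp
      right_inv := fun z => by
        ext k; fin_cases k
        · simp; ring
        · simp
        · simp
        · simp; ring }
  set A : EuclideanSpace ℝ (Fin 4) ≃L[ℝ] EuclideanSpace ℝ (Fin 4) := Alin.toContinuousLinearEquiv with hAdef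
  have hA0 : ∀ y, A y 0 = -(y 0 + y 1) := fun y => rfl
  have hA1 : ∀ y, A y 1 = y 2 := fun y => rfl
  have hA2 : ∀ y, A y 2 = y 3 := fun y => rfl
  have hA3 : ∀ y, A y 3 = y 0 - y 1 := fun y => rfl
  set Θt : OpenPartialHomeomorph X (EuclideanSpace ℝ (Fin 4)) := C.Θ.transHomeomorph A.toHomeomorph with hΘt
  have hΘtsrc : Θt.source = C.Θ.source := OpenPartialHomeomorph.transHomeomorph_source _ _
  have hΘtapply : ∀ y, Θt y = A (C.Θ y) := fun y => rfl
  have hΘtmem : Θt ∈ IsManifold.maximalAtlas (𝓡 4) ∞ X := by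
    rw [hΘt, OpenPartialHomeomorph.transHomeomorph_eq_trans]
    refine trans_mem_maximalAtlas C.Θ_mem_maximalAtlas (contDiffGroupoid_mem_of_contDiffOn_symm ?_ ?_)
    · exact A.contDiff.contDiffOn
    · exact A.symm.contDiff.contDiffOn
  -- the normal coordinates in the chart
  have hu_src : ∀ y ∈ Θt.source, u y = (fun z : EuclideanSpace ℝ (Fin 4) => (z 3 - z 0) / 2) (Θt y) := by
    intro y hy
    rw [hΘtsrc] at hy
    simp only [hΘtapply, hA0, hA3, C.apply_zero y hy, C.apply_one y hy]
    ring
  have hv_src : ∀ y ∈ Θt.source, v y = (fun z : EuclideanSpace ℝ (Fin 4) => (-z 3 - z 0) / 2) (Θt y) := by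
    intro y hy
    rw [hΘtsrc] at hy
    simp only [hΘtapply, hA0, hA3, C.apply_zero y hy, C.apply_one y hy]
    ring
  set qs : EuclideanSpace ℝ (Fin 4) := Θt x with hqsdef
  have hxU : x ∈ U := hfr.F_subset_U hx
  obtain ⟨hux, hvx⟩ := (hfr.memF_iff x hxU).1 hx
  have hqs0 : qs 0 = 0 := by
    rw [hqsdef, hΘtapply, hA0, C.apply_zero x hxC, C.apply_one x hxC, hux, hvx]; ring
  have hqs3 : qs 3 = 0 := by
    rw [hqsdef, hΘtapply, hA3, C.apply_zero x hxC, C.apply_one x hxC, hux, hvx]; ring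
  have hxsrc : x ∈ Θt.source := by rw [hΘtsrc]; exact hxC
  -- ### the region `W` around `x` and the radius `R`
  set W : Set X := Ω ∩ O ∩ ((Bxi ∩ Oκi) ∩ (Bxj ∩ Oκj) ∩ (Bxl ∩ Oκl)) with hW
  have hWo : IsOpen W := (hΩ.inter hfr.isOpen_O).inter
    (((hBxio.inter hOκio).inter (hBxjo.inter hOκjo)).inter (hBxlo.inter hOκlo))
  have hxW : x ∈ W := ⟨⟨hxΩ, hfr.F_subset_O hx⟩, ⟨⟨hxBxi, hBxiOκ hxBxi⟩, ⟨hxBxj, hBxjOκ hxBxj⟩⟩,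
    ⟨hxBxl, hBxlOκ hxBxl⟩⟩
  set D : Set (EuclideanSpace ℝ (Fin 4)) := Θt.target ∩ Θt.symm ⁻¹' W with hD
  have hDo : IsOpen D := Θt.continuousOn_symm.isOpen_inter_preimage Θt.open_target hWo
  have hqsD : qs ∈ D := ⟨Θt.map_source hxsrc, by
    show Θt.symm (Θt x) ∈ W; rw [Θt.left_inv hxsrc]; exact hxW⟩
  obtain ⟨r₀, hr₀, hballD⟩ := Metric.isOpen_iff.1 hDo qs hqsD
  set R : ℝ := r₀ / 2 with hRdef
  have hR : 0 < R := by positivity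
  have hcballD : closedBall qs R ⊆ D := (closedBall_subset_ball (by rw [hRdef]; linarith)).trans hballD
  -- ### the model
  obtain ⟨uN, vN, xs, huNs, hvNs, hdiffN, ⟨Kb, hKbc, hKbball, hout⟩, hduN, hdvN, hΨ, hxsball, huxs,
    hvxs, hcritxs, hndxs, hidxxs, huniq, hnoj, hnol, hf1, hf2, hf3, hf4, hf5, hf6⟩ :=
    Implant.exists_implant qs hqs0 hqs3 hR
  have hKbT : Kb ⊆ Θt.target := fun z hz => (hcballD (ball_subset_closedBall (hKbball hz))).1
  have hballT : ball qs R ⊆ Θt.target := fun z hz => (hcballD (ball_subset_closedBall hz)).1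
  have hballW : ∀ z ∈ ball qs R, Θt.symm z ∈ W := fun z hz => (hcballD (ball_subset_closedBall hz)).2
  -- ### the glued coordinates
  set u' : X → ℝ := Θt.source.piecewise (uN ∘ Θt) u with hu'def
  set v' : X → ℝ := Θt.source.piecewise (vN ∘ Θt) v with hv'def
  set KX : Set X := Θt.symm '' Kb with hKXdef
  obtain ⟨hKXc, hKXsrc⟩ := isCompact_symm_image (Θ := Θt) hKbc hKbT
  have hKXW : KX ⊆ W := by
    rintro _ ⟨z, hz, rfl⟩; exact hballW z (hKbball hz)
  have houtu : ∀ z ∉ Kb, uN z = (fun z : EuclideanSpace ℝ (Fin 4) => (z 3 - z 0) / 2) z :=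
    fun z hz => (hout z hz).1
  have houtv : ∀ z ∉ Kb, vN z = (fun z : EuclideanSpace ℝ (Fin 4) => (-z 3 - z 0) / 2) z :=
    fun z hz => (hout z hz).2
  have hu's : ContMDiff (𝓡 4) 𝓘(ℝ, ℝ) ∞ u' :=
    contMDiff_piecewise hΘtmem hfr.contMDiff_u huNs hu_src hKbc hKbT houtu
  have hv's : ContMDiff (𝓡 4) 𝓘(ℝ, ℝ) ∞ v' :=
    contMDiff_piecewise hΘtmem hfr.contMDiff_v hvNs hv_src hKbc hKbT houtv
  have hu'eq : ∀ y ∉ KX, u' y = u y := fun y hy => piecewise_eq_of_not_mem hu_src houtu hy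
  have hv'eq : ∀ y ∉ KX, v' y = v y := fun y hy => piecewise_eq_of_not_mem hv_src houtv hy
  have hu'src : ∀ y ∈ Θt.source, u' y = uN (Θt y) := fun y hy => piecewise_eq_of_mem_source hy
  have hv'src : ∀ y ∈ Θt.source, v' y = vN (Θt y) := fun y hy => piecewise_eq_of_mem_source hy
  have hsrcU : Θt.source ⊆ U := by rw [hΘtsrc]; exact hCO.trans hfr.O_subset_U
  have hKXU : KX ⊆ U := hKXsrc.trans hsrcU
  have hKXΩ : KX ⊆ Ω := fun y hy => (hKXW hy).1.1
  have hKXBxi : KX ⊆ Bxi := fun y hy => (hKXW hy).2.1.1.1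
  have hKXBxj : KX ⊆ Bxj := fun y hy => (hKXW hy).2.1.2.1
  have hKXBxl : KX ⊆ Bxl := fun y hy => (hKXW hy).2.2.1
  -- ### the wedge conditions
  set Pm : Fin 3 → ℝ → ℝ → Prop := fun m a b =>
    (m = i → 0 ≤ a ∧ 0 ≤ b) ∧ (m = j → a ≤ 0 ∧ a ≤ b) ∧ (m = l → b ≤ 0 ∧ b ≤ a) with hPm
  have hPi : ∀ a b, Pm i a b ↔ 0 ≤ a ∧ 0 ≤ b := fun a b =>
    ⟨fun h => h.1 rfl, fun h => ⟨fun _ => h, fun h' => absurd h' hij, fun h' => absurd h' hil⟩⟩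
  have hPj : ∀ a b, Pm j a b ↔ a ≤ 0 ∧ a ≤ b := fun a b =>
    ⟨fun h => h.2.1 rfl, fun h => ⟨fun h' => absurd h'.symm hij, fun _ => h, fun h' => absurd h' hjl⟩⟩
  have hPl : ∀ a b, Pm l a b ↔ b ≤ 0 ∧ b ≤ a := fun a b =>
    ⟨fun h => h.2.2 rfl, fun h => ⟨fun h' => absurd h'.symm hil, fun h' => absurd h'.symm hjl, fun _ => h⟩⟩
  have hcovP : ∀ a b : ℝ, ∃ m, Pm m a b := by
    intro a b
    by_cases h1 : 0 ≤ a ∧ 0 ≤ b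
    · exact ⟨i, (hPi a b).2 h1⟩
    · by_cases h2 : a ≤ b
      · refine ⟨j, (hPj a b).2 ⟨?_, h2⟩⟩
        by_contra ha; push Not at ha h1
        exact absurd (h1 ha.le) (not_lt.2 (ha.le.trans h2))
      · refine ⟨l, (hPl a b).2 ⟨?_, (not_le.1 h2).le⟩⟩
        by_contra hb; push Not at hb h1
        have hba := not_le.1 h2
        exact absurd (h1 (hb.le.trans hba.le)) (not_lt.2 hb.le)
  have hmeetP : ∀ a b : ℝ, (∀ m, Pm m a b) ↔ a = 0 ∧ b = 0 := by
    intro a b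
    constructor
    · intro h
      have h1 := (hPi a b).1 (h i); have h2 := (hPj a b).1 (h j); have h3 := (hPl a b).1 (h l)
      exact ⟨le_antisymm h2.1 h1.1, le_antisymm h3.1 h1.2⟩
    · rintro ⟨rfl, rfl⟩ m
      exact ⟨fun _ => ⟨le_rfl, le_rfl⟩, fun _ => ⟨le_rfl, le_rfl⟩, fun _ => ⟨le_rfl, le_rfl⟩⟩
  -- the old sets in `U`
  have hSold : ∀ m, ∀ y ∈ U, y ∈ S m ↔ Pm m (u y) (v y) := by
    intro m y hy
    rcases hT.eq_or m with h | h | h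
    · rw [h, hPi]; exact hT.mem_i y hy
    · rw [h, hPj]; exact hT.mem_j y hy
    · rw [h, hPl]; exact hT.mem_l y hy
  -- ### the modified sets and the new corner locus
  set S' : Fin 3 → Set X := fun m => {y | (y ∈ U ∧ Pm m (u' y) (v' y)) ∨ (y ∉ U ∧ y ∈ S m)} with hS'def
  set F' : Set X := {y | y ∈ U ∧ u' y = 0 ∧ v' y = 0} with hF'def
  have hS'U : ∀ m, ∀ y ∈ U, y ∈ S' m ↔ Pm m (u' y) (v' y) := fun m y hy =>
    mem_modifiedSet_iff_of_mem hy
  have hS'i : ∀ y ∈ U, y ∈ S' i ↔ 0 ≤ u' y ∧ 0 ≤ v' y := fun y hy => by rw [hS'U i y hy, hPi]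
  have hS'j : ∀ y ∈ U, y ∈ S' j ↔ u' y ≤ 0 ∧ u' y ≤ v' y := fun y hy => by rw [hS'U j y hy, hPj]
  have hS'l : ∀ y ∈ U, y ∈ S' l ↔ v' y ≤ 0 ∧ v' y ≤ u' y := fun y hy => by rw [hS'U l y hy, hPl]
  have hS'off : ∀ m, ∀ y ∉ KX, y ∈ S' m ↔ y ∈ S m := fun m y hy =>
    mem_modifiedSet_iff_of_not_mem (hSold m) hu'eq hv'eq hy
  have hPclosed : ∀ m, IsClosed {p : ℝ × ℝ | Pm m p.1 p.2} := by
    intro m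
    rcases hT.eq_or m with h | h | h <;> rw [h]
    · have : {p : ℝ × ℝ | Pm i p.1 p.2} = {p : ℝ × ℝ | 0 ≤ p.1 ∧ 0 ≤ p.2} := by
        ext p; exact hPi p.1 p.2
      rw [this]
      exact (isClosed_le continuous_const continuous_fst).inter (isClosed_le continuous_const continuous_snd)
    · have : {p : ℝ × ℝ | Pm j p.1 p.2} = {p : ℝ × ℝ | p.1 ≤ 0 ∧ p.1 ≤ p.2} := by
        ext p; exact hPj p.1 p.2
      rw [this]
      exact (isClosed_le continuous_fst continuous_const).inter (isClosed_le continuous_fst continuous_snd)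
    · have : {p : ℝ × ℝ | Pm l p.1 p.2} = {p : ℝ × ℝ | p.2 ≤ 0 ∧ p.2 ≤ p.1} := by
        ext p; exact hPl p.1 p.2
      rw [this]
      exact (isClosed_le continuous_snd continuous_const).inter (isClosed_le continuous_snd continuous_fst)
  have hS'c : ∀ m, IsCompact (S' m) := fun m =>
    isCompact_modifiedSet (hT.isCompact m) hKXc hKXU (hPclosed m) hfr.contMDiff_u.continuous
      hfr.contMDiff_v.continuous hu's.continuous hv's.continuous (hSold m) hu'eq hv'eq
  have hcover' : (⋃ m, S' m) = univ := iUnion_modifiedSet_eq_univ hcovP hT.cover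
  have hFU : (⋂ m, S m) ⊆ U := hfr.F_subset_U
  have hF'eq : (⋂ m, S' m) = F' := iInter_modifiedSet_eq hmeetP hFU
  have hF'U : F' ⊆ U := fun y hy => hy.1
  have hF'mem : ∀ y ∈ U, y ∈ F' ↔ u' y = 0 ∧ v' y = 0 := fun y hy =>
    ⟨fun h => h.2, fun h => ⟨hy, h⟩⟩
  have hF'c : IsCompact F' := isCompact_newCorner hfr.isCompact_F hFU hKXc hKXU hu's.continuous
    hv's.continuous hfr.memF_iff hu'eq hv'eq
  have hF'sub : F' ⊆ (⋂ m, S m) ∪ KX := newCorner_subset hfr.memF_iff hu'eq hv'eq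
  have hF'off : ∀ y ∉ KX, y ∈ F' ↔ y ∈ ⋂ m, S m := fun y hy =>
    mem_newCorner_iff_of_not_mem hFU hfr.memF_iff hu'eq hv'eq hy
  -- ### adapted charts along `F'` and the new product structure
  have hchart' : ∀ x' ∈ F', ∃ Ξ : OpenPartialHomeomorph X (EuclideanSpace ℝ (Fin 4)),
      Ξ ∈ IsManifold.maximalAtlas (𝓡 4) ∞ X ∧ x' ∈ Ξ.source ∧
      ∀ y ∈ Ξ.source, Ξ y 0 = u' y ∧ Ξ y 1 = v' y := by
    intro x' hx'
    by_cases hx'src : x' ∈ Θt.source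
    · obtain ⟨hu0, hv0⟩ := (hF'mem x' (hF'U hx')).1 hx'
      rw [hu'src x' hx'src] at hu0
      rw [hv'src x' hx'src] at hv0
      obtain ⟨Ψ, hzΨ, hΨs, hΨsymm, hΨ01⟩ := hΨ (Θt x') hu0 hv0
      refine ⟨Θt.trans Ψ, trans_mem_maximalAtlas hΘtmem (contDiffGroupoid_mem_of_contDiffOn_symm hΨs hΨsymm),
        ⟨hx'src, hzΨ⟩, fun y hy => ?_⟩
      obtain ⟨hysrc, hyΨ⟩ := hy
      have h := hΨ01 (Θt y) hyΨ
      simp only [OpenPartialHomeomorph.trans_apply]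
      rw [h.1, h.2, hu'src y hysrc, hv'src y hysrc]
      exact ⟨rfl, rfl⟩
    · have hx'K : x' ∉ KX := fun h => hx'src (hKXsrc h)
      have hx'F : x' ∈ ⋂ m, S m := (hF'off x' hx'K).1 hx'
      obtain ⟨C', hx'C', -⟩ := hT.sector_i.corner x' hx'F
      refine ⟨C'.Θ.restr KXᶜ, restr_mem_maximalAtlas _ C'.Θ_mem_maximalAtlas hKXc.isClosed.isOpen_compl,
        ?_, fun y hy => ?_⟩
      · rw [OpenPartialHomeomorph.restr_source, hKXc.isClosed.isOpen_compl.interior_eq]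
        exact ⟨hx'C', hx'K⟩
      · rw [OpenPartialHomeomorph.restr_source, hKXc.isClosed.isOpen_compl.interior_eq] at hy
        simp only [OpenPartialHomeomorph.restr_apply]
        rw [C'.apply_zero y hy.1, C'.apply_one y hy.1, hu'eq y hy.2, hv'eq y hy.2]
        exact ⟨rfl, rfl⟩
  obtain ⟨O', ρ', hO'o, hF'O', hO'U, hρ's, hρ'F', hρ'fix, hρ'O', hci'⟩ :=
    exists_cornerSliceChart_of_normalCoordinates hu's hv's hfr.isOpen_U hF'c hF'U hS'i hF'mem hchart'
  have hfr' : NormalFrame F' u' v' ρ' U O' :=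
    { isOpen_U := hfr.isOpen_U
      isOpen_O := hO'o
      isCompact_F := hF'c
      F_subset_O := hF'O'
      O_subset_U := hO'U
      contMDiff_u := hu's
      contMDiff_v := hv's
      contMDiff_ρ := hρ's
      memF_iff := hF'mem
      ρ_mem := hρ'F'
      ρ_eq_self := hρ'fix
      mapsTo_ρ := hρ'O' }
  -- corner-slice charts of the three new sectors
  have hcj' : ∀ x' ∈ F', ∃ C : CornerSliceChart (S' j) F' (fun y => v' y - u' y) (fun y => -u' y) ρ',
      x' ∈ C.Θ.source ∧ C.Θ.source ⊆ O' := by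
    intro x' hx'
    obtain ⟨Cn, hxCn, hCnO⟩ := hci' x' hx'
    refine ⟨Cn.relabelTriRot (fun q hq => hS'j q (hO'U (hCnO hq))), ?_, ?_⟩
    · rw [Cn.relabelTriRot_source]; exact hxCn
    · rw [Cn.relabelTriRot_source]; exact hCnO
  have hcl' : ∀ x' ∈ F', ∃ C : CornerSliceChart (S' l) F' (fun y => -v' y) (fun y => u' y - v' y) ρ',
      x' ∈ C.Θ.source ∧ C.Θ.source ⊆ O' := by
    intro x' hx'
    obtain ⟨Cn, hxCn, hCnO⟩ := hci' x' hx'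
    refine ⟨Cn.relabelTriRot₂ (fun q hq => hS'l q (hO'U (hCnO hq))), ?_, ?_⟩
    · rw [Cn.relabelTriRot₂_source]; exact hxCn
    · rw [Cn.relabelTriRot₂_source]; exact hCnO
  -- ### regularity of the new coordinates on the carrier
  have hreg_src : ∀ {w : X → ℝ} {g : EuclideanSpace ℝ (Fin 4) → ℝ}, ContMDiff (𝓡 4) 𝓘(ℝ, ℝ) ∞ w →
      (∀ y ∈ Θt.source, w y = g (Θt y)) → (∀ z, fderiv ℝ g z ≠ 0) →
      ∀ y ∈ KX, ¬ IsMCriticalPt (𝓡 4) w y := by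
    intro w g hws hwg hg y hyK hcr
    have hy : y ∈ Θt.source := hKXsrc hyK
    have heq : (w ∘ Θt.symm) =ᶠ[𝓝 (Θt y)] g := by
      filter_upwards [Θt.open_target.mem_nhds (Θt.map_source hy)] with z hz
      simp only [comp_apply, hwg _ (Θt.map_target hz), Θt.right_inv hz]
    have h1 := (morseData_of_comp_symm_eventuallyEq hΘtmem hws hy heq).1
    rw [h1, MorseBirth.isMCriticalPt_iff_fderiv] at hcr
    exact hg _ hcr
  have hduN' : ∀ z, fderiv ℝ uN z ≠ 0 := fun z h0 => by
    have := hduN z; rw [h0] at this; simp at this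
  have hdvN' : ∀ z, fderiv ℝ vN z ≠ 0 := fun z h0 => by
    have := hdvN z; rw [h0] at this; simp at this
  have hd3 : ∀ z : EuclideanSpace ℝ (Fin 4), fderiv ℝ (fun z : EuclideanSpace ℝ (Fin 4) => z 3) z ≠ 0 := by
    intro z h0
    have hd : HasFDerivAt (fun z : EuclideanSpace ℝ (Fin 4) => z 3)
        (EuclideanSpace.proj (3 : Fin 4) : EuclideanSpace ℝ (Fin 4) →L[ℝ] ℝ) z :=
      (EuclideanSpace.proj (3 : Fin 4) : EuclideanSpace ℝ (Fin 4) →L[ℝ] ℝ).hasFDerivAt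
    rw [hd.fderiv] at h0
    have := congrArg (fun L : EuclideanSpace ℝ (Fin 4) →L[ℝ] ℝ => L (EuclideanSpace.single 3 1)) h0
    simp at this
  have hdneg : ∀ {g : EuclideanSpace ℝ (Fin 4) → ℝ}, Differentiable ℝ g → (∀ z, fderiv ℝ g z ≠ 0) →
      ∀ z, fderiv ℝ (fun z => -g z) z ≠ 0 := by
    intro g hg hreg z h0
    have hd : HasFDerivAt (fun z => -g z) (-fderiv ℝ g z) z := (hg z).hasFDerivAt.neg
    rw [hd.fderiv, neg_eq_zero] at h0
    exact hreg z h0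
  have hvu : (fun z => vN z - uN z) = fun z : EuclideanSpace ℝ (Fin 4) => -z 3 := by
    funext z; have := hdiffN z; linarith
  have huv : (fun z => uN z - vN z) = fun z : EuclideanSpace ℝ (Fin 4) => z 3 := by
    funext z; exact hdiffN z
  have hdvu : ∀ z, fderiv ℝ (fun z => vN z - uN z) z ≠ 0 := by
    rw [hvu]; exact hdneg (by fun_prop) hd3
  have hduv : ∀ z, fderiv ℝ (fun z => uN z - vN z) z ≠ 0 := by rw [huv]; exact hd3
  have hdnu : ∀ z, fderiv ℝ (fun z => -uN z) z ≠ 0 := hdneg (huNs.differentiable (by simp)) hduN'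
  have hdnv : ∀ z, fderiv ℝ (fun z => -vN z) z ≠ 0 := hdneg (hvNs.differentiable (by simp)) hdvN'
  -- the coordinates of the three sectors through the chart
  have hu'src' : ∀ y ∈ Θt.source, u' y = uN (Θt y) := hu'src
  have hju'src : ∀ y ∈ Θt.source, (fun y => v' y - u' y) y = (fun z => vN z - uN z) (Θt y) :=
    fun y hy => by simp only [hu'src y hy, hv'src y hy]
  have hjv'src : ∀ y ∈ Θt.source, (fun y => -u' y) y = (fun z => -uN z) (Θt y) :=
    fun y hy => by simp only [hu'src y hy]
  have hlu'src : ∀ y ∈ Θt.source, (fun y => -v' y) y = (fun z => -vN z) (Θt y) :=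
    fun y hy => by simp only [hv'src y hy]
  have hlv'src : ∀ y ∈ Θt.source, (fun y => u' y - v' y) y = (fun z => uN z - vN z) (Θt y) :=
    fun y hy => by simp only [hu'src y hy, hv'src y hy]
  have hjusrc : ∀ y ∈ Θt.source, (fun y => v y - u y) y = (fun z : EuclideanSpace ℝ (Fin 4) => -z 3) (Θt y) :=
    fun y hy => by simp only [hu_src y hy, hv_src y hy]; ring
  have hjvsrc : ∀ y ∈ Θt.source, (fun y => -u y) y = (fun z : EuclideanSpace ℝ (Fin 4) => (z 0 - z 3) / 2) (Θt y) :=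
    fun y hy => by simp only [hu_src y hy]; ring
  have hlusrc : ∀ y ∈ Θt.source, (fun y => -v y) y = (fun z : EuclideanSpace ℝ (Fin 4) => (z 3 + z 0) / 2) (Θt y) :=
    fun y hy => by simp only [hv_src y hy]; ring
  have hlvsrc : ∀ y ∈ Θt.source, (fun y => u y - v y) y = (fun z : EuclideanSpace ℝ (Fin 4) => z 3) (Θt y) :=
    fun y hy => by simp only [hu_src y hy, hv_src y hy]; ring
  -- smoothness of the relabelled coordinates
  have hju's : ContMDiff (𝓡 4) 𝓘(ℝ, ℝ) ∞ fun y => v' y - u' y := hv's.sub hu's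
  have hjv's : ContMDiff (𝓡 4) 𝓘(ℝ, ℝ) ∞ fun y => -u' y := hu's.neg
  have hlu's : ContMDiff (𝓡 4) 𝓘(ℝ, ℝ) ∞ fun y => -v' y := hv's.neg
  have hlv's : ContMDiff (𝓡 4) 𝓘(ℝ, ℝ) ∞ fun y => u' y - v' y := hu's.sub hv's
  -- descriptions of the new sectors in the relabelled coordinates
  have hS'j' : ∀ y ∈ U, y ∈ S' j ↔ 0 ≤ v' y - u' y ∧ 0 ≤ -u' y := fun y hy => by
    rw [hS'j y hy]; constructor <;> intro h <;> constructor <;> linarith [h.1, h.2]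
  have hS'l' : ∀ y ∈ U, y ∈ S' l ↔ 0 ≤ -v' y ∧ 0 ≤ u' y - v' y := fun y hy => by
    rw [hS'l y hy]; constructor <;> intro h <;> constructor <;> linarith [h.1, h.2]
  have hF'j : ∀ y ∈ U, y ∈ F' ↔ v' y - u' y = 0 ∧ -u' y = 0 := fun y hy => by
    rw [hF'mem y hy]; constructor <;> intro h <;> constructor <;> linarith [h.1, h.2]
  have hF'l : ∀ y ∈ U, y ∈ F' ↔ -v' y = 0 ∧ u' y - v' y = 0 := fun y hy => by
    rw [hF'mem y hy]; constructor <;> intro h <;> constructor <;> linarith [h.1, h.2]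
  have hFnotint : ∀ m, ∀ x' ∈ ⋂ m, S m, x' ∉ interior (S m) := by
    intro m x' hx'
    rcases hT.eq_or m with h | h | h <;> rw [h]
    · exact hT.sector_i.not_mem_interior_of_mem_F hx'
    · exact hT.sector_j.not_mem_interior_of_mem_F hx'
    · exact hT.sector_l.not_mem_interior_of_mem_F hx'
  -- ### half-slice charts of the new sectors
  have hhalf'i := exists_halfSliceChart_of_implant hfr.isOpen_U hKXc hKXU hu's hv's hS'i hF'mem (hS'off i)
    hF'off hT.sector_i.half (hreg_src hu's hu'src hduN') (hreg_src hv's hv'src hdvN')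
  have hhalf'j := exists_halfSliceChart_of_implant hfr.isOpen_U hKXc hKXU hju's hjv's hS'j' hF'j (hS'off j)
    hF'off hT.sector_j.half (hreg_src hju's hju'src hdvu) (hreg_src hjv's hjv'src hdnu)
  have hhalf'l := exists_halfSliceChart_of_implant hfr.isOpen_U hKXc hKXU hlu's hlv's hS'l' hF'l (hS'off l)
    hF'off hT.sector_l.half (hreg_src hlu's hlu'src hdnv) (hreg_src hlv's hlv'src hduv)
  -- ### the raw presentations of the new sectors
  have hκi₀ : 0 < κi x := hκipos x (hFOκi hx)
  have hκj₀ : 0 < κj x := hκjpos x (hFOκj hx)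
  have hκl₀ : 0 < κl x := hκlpos x (hFOκl hx)
  have hxsT : ({xs} : Set (EuclideanSpace ℝ (Fin 4))) ⊆ Θt.target := by
    intro z hz; rw [mem_singleton_iff.1 hz]; exact hballT hxsball
  have hxsKb : xs ∈ Kb := Implant.mem_of_isMCriticalPt_quadrant hKbc.isClosed hout huxs hcritxs
  have hXsKXi : ∀ z ∈ ({xs} : Set (EuclideanSpace ℝ (Fin 4))), Θt.symm z ∈ KX := by
    intro z hz; rw [mem_singleton_iff.1 hz]; exact ⟨xs, hxsKb, rfl⟩
  have hXsi : ∀ z ∈ ({xs} : Set (EuclideanSpace ℝ (Fin 4))), 0 < uN z ∧ 0 < vN z ∧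
      IsMCriticalPt (𝓡 4) (fun z => -(uN z * vN z)) z ∧
      (mhessian (𝓡 4) (fun z => -(uN z * vN z)) z).Nondegenerate ∧
      morseIndex (𝓡 4) (fun z => -(uN z * vN z)) z = 1 := by
    intro z hz; rw [mem_singleton_iff.1 hz]; exact ⟨huxs, hvxs, hcritxs, hndxs, hidxxs⟩
  have hcriti : ∀ z ∈ Θt.target, Θt.symm z ∈ KX → 0 < uN z → 0 < vN z →
      IsMCriticalPt (𝓡 4) (fun z => -(uN z * vN z)) z → z ∈ ({xs} : Set (EuclideanSpace ℝ (Fin 4))) :=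
    fun z _ _ hu hv hcr => mem_singleton_iff.2 (huniq z hu hv hcr)
  obtain ⟨hinti, hGnis, hGnformi, hb1i', hi1i', hb2i', hi2i', hci'raw⟩ :=
    sector_rawPresentation_of_implant (am := fun z : EuclideanSpace ℝ (Fin 4) => (z 3 - z 0) / 2)
      (bm := fun z : EuclideanSpace ℝ (Fin 4) => (-z 3 - z 0) / 2) (aN := uN) (bN := vN)
      hΘtmem hfr.isOpen_U hsrcU hKXc hKXsrc (hT.isCompact i)
      hfr.contMDiff_u hfr.contMDiff_v hT.sector_i.interior_iff (hFnotint i) hGis hOκio hFOκi hGiform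
      hb1i hi1i hb2i hi2i hnocriti hci hBxio hKXBxi hBxiOκ hκiconst hκi₀ hu's hv's hS'i (hS'off i)
      hF'mem hF'off hu'eq hv'eq huNs hvNs hu_src hv_src hu'src hv'src hduN' hdvN' hf1 hf2
      (finite_singleton xs) hxsT hXsKXi hXsi hcriti
  have hXsj : ∀ z ∈ (∅ : Set (EuclideanSpace ℝ (Fin 4))), 0 < (fun z => vN z - uN z) z ∧ 0 < (fun z => -uN z) z ∧
      IsMCriticalPt (𝓡 4) (fun z => -((fun z => vN z - uN z) z * (fun z => -uN z) z)) z ∧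
      (mhessian (𝓡 4) (fun z => -((fun z => vN z - uN z) z * (fun z => -uN z) z)) z).Nondegenerate ∧
      morseIndex (𝓡 4) (fun z => -((fun z => vN z - uN z) z * (fun z => -uN z) z)) z = 1 :=
    fun z hz => absurd hz (notMem_empty z)
  have hcritj : ∀ z ∈ Θt.target, Θt.symm z ∈ KX → 0 < (fun z => vN z - uN z) z → 0 < (fun z => -uN z) z →
      IsMCriticalPt (𝓡 4) (fun z => -((fun z => vN z - uN z) z * (fun z => -uN z) z)) z →
      z ∈ (∅ : Set (EuclideanSpace ℝ (Fin 4))) :=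
    fun z _ _ hu hv hcr => absurd hcr (hnoj z hu hv)
  obtain ⟨hintj, hGnjs, hGnformj, hb1j', hi1j', hb2j', hi2j', hcj'raw⟩ :=
    sector_rawPresentation_of_implant (um := fun y => v y - u y) (vm := fun y => -u y)
      (un := fun y => v' y - u' y) (vn := fun y => -u' y)
      (am := fun z : EuclideanSpace ℝ (Fin 4) => -z 3)
      (bm := fun z : EuclideanSpace ℝ (Fin 4) => (z 0 - z 3) / 2) (aN := fun z => vN z - uN z)
      (bN := fun z => -uN z) (Xs := ∅)
      hΘtmem hfr.isOpen_U hsrcU hKXc hKXsrc (hT.isCompact j)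
      (hfr.contMDiff_v.sub hfr.contMDiff_u) hfr.contMDiff_u.neg hT.sector_j.interior_iff (hFnotint j)
      hGjs hOκjo hFOκj hGjform hb1j hi1j hb2j hi2j hnocritj hcj hBxjo hKXBxj hBxjOκ hκjconst hκj₀
      hju's hjv's hS'j' (hS'off j) hF'j hF'off
      (fun y hy => by simp only [hu'eq y hy, hv'eq y hy]) (fun y hy => by simp only [hu'eq y hy])
      (hvNs.sub huNs) huNs.neg hjusrc hjvsrc hju'src hjv'src hdvu hdnu hf3 hf4
      finite_empty (empty_subset _) (fun z hz => absurd hz (notMem_empty z)) hXsj hcritj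
  have hXsl : ∀ z ∈ (∅ : Set (EuclideanSpace ℝ (Fin 4))), 0 < (fun z => -vN z) z ∧ 0 < (fun z => uN z - vN z) z ∧
      IsMCriticalPt (𝓡 4) (fun z => -((fun z => -vN z) z * (fun z => uN z - vN z) z)) z ∧
      (mhessian (𝓡 4) (fun z => -((fun z => -vN z) z * (fun z => uN z - vN z) z)) z).Nondegenerate ∧
      morseIndex (𝓡 4) (fun z => -((fun z => -vN z) z * (fun z => uN z - vN z) z)) z = 1 :=
    fun z hz => absurd hz (notMem_empty z)
  have hcritl : ∀ z ∈ Θt.target, Θt.symm z ∈ KX → 0 < (fun z => -vN z) z → 0 < (fun z => uN z - vN z) z →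
      IsMCriticalPt (𝓡 4) (fun z => -((fun z => -vN z) z * (fun z => uN z - vN z) z)) z →
      z ∈ (∅ : Set (EuclideanSpace ℝ (Fin 4))) :=
    fun z _ _ hu hv hcr => absurd hcr (hnol z hu hv)
  obtain ⟨hintl, hGnls, hGnforml, hb1l', hi1l', hb2l', hi2l', hcl'raw⟩ :=
    sector_rawPresentation_of_implant (um := fun y => -v y) (vm := fun y => u y - v y)
      (un := fun y => -v' y) (vn := fun y => u' y - v' y)
      (am := fun z : EuclideanSpace ℝ (Fin 4) => (z 3 + z 0) / 2)
      (bm := fun z : EuclideanSpace ℝ (Fin 4) => z 3) (aN := fun z => -vN z)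
      (bN := fun z => uN z - vN z) (Xs := ∅)
      hΘtmem hfr.isOpen_U hsrcU hKXc hKXsrc (hT.isCompact l)
      hfr.contMDiff_v.neg (hfr.contMDiff_u.sub hfr.contMDiff_v) hT.sector_l.interior_iff (hFnotint l)
      hGls hOκlo hFOκl hGlform hb1l hi1l hb2l hi2l hnocritl hcl hBxlo hKXBxl hBxlOκ hκlconst hκl₀
      hlu's hlv's hS'l' (hS'off l) hF'l hF'off
      (fun y hy => by simp only [hv'eq y hy]) (fun y hy => by simp only [hu'eq y hy, hv'eq y hy])
      hvNs.neg (huNs.sub hvNs) hlusrc hlvsrc hlu'src hlv'src hdnv hduv hf5 hf6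
      finite_empty (empty_subset _) (fun z hz => absurd hz (notMem_empty z)) hXsl hcritl
  -- ### renormalising to the new retraction
  have hF'Oκ : ∀ {Oκm Bxm : Set X}, (⋂ m, S m) ⊆ Oκm → KX ⊆ Bxm → Bxm ⊆ Oκm →
      F' ⊆ Oκm ∩ (KXᶜ ∪ Bxm) ∩ O' := by
    intro Oκm Bxm hFO hKB hBO y hy
    refine ⟨⟨?_, ?_⟩, hF'O' hy⟩
    · rcases hF'sub hy with h | h
      · exact hFO h
      · exact hBO (hKB h)
    · by_cases hyK : y ∈ KX
      · exact Or.inr (hKB hyK)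
      · exact Or.inl hyK
  have hopen3 : ∀ {Oκm Bxm : Set X}, IsOpen Oκm → IsOpen Bxm → IsOpen (Oκm ∩ (KXᶜ ∪ Bxm) ∩ O') :=
    fun hO hB => (hO.inter (hKXc.isClosed.isOpen_compl.union hB)).inter hO'o
  set c' : Fin 3 → ℕ → ℕ := Function.update c i (fun n => c i n + if n = 1 then 1 else 0) with hc'def
  have hc'i : ∀ n, (interior (S' i) ∩ criticalSetOfIndex (𝓡 4)
      (fun y => Gi y + 2 * κi x * (u y * v y - u' y * v' y)) n).ncard = c' i n := by
    intro n
    rw [hci'raw n, hc'def, Function.update_self]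
    simp
  have hc'j : ∀ n, (interior (S' j) ∩ criticalSetOfIndex (𝓡 4)
      (fun y => Gj y + 2 * κj x * ((fun y => v y - u y) y * (fun y => -u y) y -
        (fun y => v' y - u' y) y * (fun y => -u' y) y)) n).ncard = c' j n := by
    intro n
    rw [hcj'raw n, hc'def, Function.update_of_ne (Ne.symm hij)]
    simp
  have hc'l : ∀ n, (interior (S' l) ∩ criticalSetOfIndex (𝓡 4)
      (fun y => Gl y + 2 * κl x * ((fun y => -v y) y * (fun y => u y - v y) y -
        (fun y => -v' y) y * (fun y => u' y - v' y) y)) n).ncard = c' l n := by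
    intro n
    rw [hcl'raw n, hc'def, Function.update_of_ne (Ne.symm hil)]
    simp
  have hSi' : SectorNormalForm (S' i) F' u' v' ρ' U O' (c' i) :=
    sectorNormalForm_of_rawPresentation hfr' (hS'c i) hS'i hinti hci' hhalf'i hGnis hκis
      (hopen3 hOκio hBxio) (hF'Oκ hFOκi hKXBxi hBxiOκ) (fun y hy => hy.2)
      (fun y hy => hκipos y hy.1.1) (fun y hy => hGnformi y hy.1) hb1i' hi1i' hb2i' hi2i' hc'i
  have hSj' : SectorNormalForm (S' j) F' (fun y => v' y - u' y) (fun y => -u' y) ρ' U O' (c' j) :=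
    sectorNormalForm_of_rawPresentation hfr'.relabelTriRot (hS'c j) hS'j' hintj hcj' hhalf'j hGnjs hκjs
      (hopen3 hOκjo hBxjo) (hF'Oκ hFOκj hKXBxj hBxjOκ) (fun y hy => hy.2)
      (fun y hy => hκjpos y hy.1.1) (fun y hy => hGnformj y hy.1) hb1j' hi1j' hb2j' hi2j' hc'j
  have hSl' : SectorNormalForm (S' l) F' (fun y => -v' y) (fun y => u' y - v' y) ρ' U O' (c' l) :=
    sectorNormalForm_of_rawPresentation hfr'.relabelTriRot₂ (hS'c l) hS'l' hintl hcl' hhalf'l hGnls hκls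
      (hopen3 hOκlo hBxlo) (hF'Oκ hFOκl hKXBxl hBxlOκ) (fun y hy => hy.2)
      (fun y hy => hκlpos y hy.1.1) (fun y hy => hGnforml y hy.1) hb1l' hi1l' hb2l' hi2l' hc'l
  -- ### disjointness of the new sectors
  have hint'U : ∀ m, ∀ y ∈ U, y ∈ interior (S' m) →
      (m = i → 0 < u' y ∧ 0 < v' y) ∧ (m = j → 0 < v' y - u' y ∧ 0 < -u' y) ∧
      (m = l → 0 < -v' y ∧ 0 < u' y - v' y) := by
    intro m y hyU hyint
    refine ⟨?_, ?_, ?_⟩ <;> rintro rfl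
    · exact (hinti y hyU (interior_subset hyint)).1 hyint
    · exact (hintj y hyU (interior_subset hyint)).1 hyint
    · exact (hintl y hyU (interior_subset hyint)).1 hyint
  have hdisj' : ∀ m m', m ≠ m' → Disjoint (interior (S' m)) (S' m') := by
    intro m m' hmm'
    rw [Set.disjoint_left]
    intro y hyint hym'
    by_cases hyU : y ∈ U
    · have hstr := hint'U m y hyU hyint
      have hmem' := (hS'U m' y hyU).1 hym'
      rcases hT.eq_or m with rfl | rfl | rfl <;> rcases hT.eq_or m' with rfl | rfl | rfl
      · exact hmm' rfl
      · have h1 := hstr.1 rfl; have h2 := (hPj _ _).1 hmem'; linarith [h1.1, h2.1]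
      · have h1 := hstr.1 rfl; have h2 := (hPl _ _).1 hmem'; linarith [h1.2, h2.1]
      · have h1 := hstr.2.1 rfl; have h2 := (hPi _ _).1 hmem'; linarith [h1.2, h2.1]
      · exact hmm' rfl
      · have h1 := hstr.2.1 rfl; have h2 := (hPl _ _).1 hmem'; linarith [h1.1, h2.2]
      · have h1 := hstr.2.2 rfl; have h2 := (hPi _ _).1 hmem'; linarith [h1.1, h2.2]
      · have h1 := hstr.2.2 rfl; have h2 := (hPj _ _).1 hmem'; linarith [h1.2, h2.2]
      · exact hmm' rfl
    · have hyK : y ∉ KX := fun h => hyU (hKXU h)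
      have hS'eq : ∀ m, S' m ∩ KXᶜ = S m ∩ KXᶜ := by
        intro m; ext z; constructor
        · rintro ⟨h1, h2⟩; exact ⟨(hS'off m z h2).1 h1, h2⟩
        · rintro ⟨h1, h2⟩; exact ⟨(hS'off m z h2).2 h1, h2⟩
      have hyintS : y ∈ interior (S m) :=
        (mem_interior_iff_of_inter_eq hKXc.isClosed.isOpen_compl (hS'eq m) hyK).1 hyint
      have hymS : y ∈ S m' := (hS'off m' y hyK).1 hym'
      exact Set.disjoint_left.1 (hT.disjoint m m' hmm') hyintS hymS
  -- ### the new trisection in normal form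
  refine ⟨S', u', v', ρ', O', ?_, fun m y hy => hS'off m y (fun h => hy (hKXΩ h)),
    fun y hy => ⟨hu'eq y (fun h => hy (hKXΩ h)), hv'eq y (fun h => hy (hKXΩ h))⟩⟩
  rw [← hF'eq] at hfr' hSi' hSj' hSl'
  exact
    { ne_ij := hij
      ne_jl := hjl
      ne_il := hil
      cover := hcover'
      frame := hfr'
      mem_j := hS'j
      mem_l := hS'l
      sector_i := hSi'
      sector_j := hSj'
      sector_l := hSl'
      disjoint := hdisj' }

end Implant

end Literature.Topology.FourManifolds
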